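import Summits.PneNP.PneNP.Theses.PositionalGames
import Summits.PneNP.PneNP.Theorems.PositionalGamesParityToMpgArith
import Summits.PneNP.PneNP.Theorems.PositionalGamesParityToMpgCircuits

/-!
# PneNP / PositionalGames — glue `ParityToMpg` (item stmt-PneNP-1301)

`Summit.PneNP.PneNP.Theses.PositionalGames.ParityToMpg :
ParityMonotoneSuperpoly → MpgMonotoneSuperpoly` — superpolynomial MONOTONE lower bounds for the
winning regions of parity games (route encoding: owner map `o`, priorities `p`, start `v`; input
bit `(u,w)` = "edge present" for Even `u`, "edge absent" for Odd `u`; `∃σ ∀τ` lasso form) imply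
superpolynomial monotone lower bounds for threshold mean-payoff games with `m`-bit weights on `m`
vertices.

Proof (Jurdziński 1998, "Deciding the winner in parity games is in UP ∩ co-UP", Inform. Process.
Lett. 68, the reduction parity → mean payoff, read as a monotone projection; Jukna 2012 §1.4):

* §1 (`ptm_reduction`, `ptm_gadget`) the gadget and its semantics. Given a parity template on
  `Fin n` (priorities first compressed below `2n`, `ptm_compress`) and `m` with `2n² < m`, the
  mean-payoff template on `Fin m` keeps the owners of the embedded vertices `Fin.castLE _ u`, makes
  the padding vertices Even with exactly a present self-loop, makes all edges into the padding
  absent, and gives embedded `u` the constant weight `2^{m-1} + (-2^n)^{q u} ∈ [0, 2^m)`; every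
  input bit of the mean-payoff game is thus a constant or an input bit of the parity game
  (a substitution `ρ`). Legal positional strategies correspond, the lasso cycle is transported
  along the embedding (`ptm_cycle_map`), and "cycle mean `≥ 2^{m-1}`" reads
  `0 ≤ ∑_{u ∈ C} (-2^n)^{q u}`, i.e. the top priority on the cycle is even (`ptm_sign_iff`).
* §2 (`parityToMpg_proof`) the transfer. Monotone complexity does not increase under such
  substitutions (`ptm_transfer_step`: constant elimination
  `Literature.Barriers.PneNP.GateList.substElim_wire` in an optimal `{∧₂, ∨₂}`-circuit of the
  mean-payoff function, which exists because that function is monotone, `ptm_mpg_mono`, and not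
  constant); the exponents are adjusted by choosing `n` maximal with `2n² < m`
  (`m ≤ 2(n+1)² ≤ 8n²`, parity hardness used at exponent `2k+1`).
-/

namespace Summit.PneNP.PneNP.Theorems

open Literature.Computability.Complexity Finset Filter

/-! ## §1 The gadget: parity game ↦ threshold mean-payoff game (semantics) -/

open scoped Classical

/-- **Semantics of the Jurdziński gadget** (hypothesis form). Parity template `(o, p, v)` on
`Fin n`, compressed priorities `q < 2n` with the same parity of maxima as `p`; mean-payoff
template on `Fin m`, `2n² < m`: embedded vertices `Fin.castLE hnm u` keep their owners (`ho'₁`),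
padding vertices are Even (`ho'₂`); the substituted input `x'` copies the edge bits between
embedded vertices (`hx₁`), makes edges from embedded to padding vertices absent (`hx₂`: bit
`false` for Even sources, `true` for Odd sources), gives padding vertices exactly a present
self-loop (`hx₃`), and writes the binary digits of `W u = 2^{m-1} + (-2^n)^{q u}` as the weight
bits of embedded `u` (`hx₄`). Then Even wins the mean-payoff game (threshold: cycle mean
`≥ 2^{m-1}`, in the route's `∃σ ∀τ` lasso form) from `v` iff Even wins the parity game from `v`:
legal positional strategies correspond (moves into the padding are never legal, padding
self-loops always are), the lasso cycle is transported along the embedding, and on a cycle `C`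
the mean condition reads `0 ≤ ∑_{u∈C} (-2^n)^{q u}`, i.e. (sign lemma) the top priority on `C`
is even. [folklore] -/
theorem ptm_reduction {n m : ℕ} (hm : 2 * n ^ 2 < m) (hnm : n ≤ m) (o : Fin n → Bool)
    (p q : Fin n → ℕ) (hq : ∀ u, q u < 2 * n)
    (hpq : ∀ C : Finset (Fin n), C.Nonempty → (Even (C.sup q) ↔ Even (C.sup p)))
    (v : Fin n)
    (o' : Fin m → Bool) (ho'₁ : ∀ u : Fin n, o' (Fin.castLE hnm u) = o u)
    (ho'₂ : ∀ u' : Fin m, ¬ (u' : ℕ) < n → o' u' = true)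
    (W : Fin n → ℕ) (hW : ∀ u, (W u : ℤ) = 2 ^ (m - 1) + (-(2 : ℤ) ^ n) ^ q u)
    (x : Fin n × Fin n → Bool) (x' : (Fin m × Fin m) ⊕ (Fin m × Fin m) → Bool)
    (hx₁ : ∀ u w : Fin n, x' (Sum.inl (Fin.castLE hnm u, Fin.castLE hnm w)) = x (u, w))
    (hx₂ : ∀ (u : Fin n) (w' : Fin m), ¬ (w' : ℕ) < n →
      x' (Sum.inl (Fin.castLE hnm u, w')) = !(o u))
    (hx₃ : ∀ u' w' : Fin m, ¬ (u' : ℕ) < n → x' (Sum.inl (u', w')) = decide (w' = u'))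
    (hx₄ : ∀ (u : Fin n) (j : Fin m), x' (Sum.inr (Fin.castLE hnm u, j)) = (W u).testBit j) :
    (∃ σ : Fin m → Fin m, (∀ u, o' u = true → x' (Sum.inl (u, σ u)) = true) ∧
      ∀ τ : Fin m → Fin m, (∀ u, o' u = false → x' (Sum.inl (u, τ u)) = false) →
        2 ^ m * (Finset.univ.filter fun u : Fin m => ∃ᶠ t : ℕ in Filter.atTop,
            (fun w : Fin m => if o' w = true then σ w else τ w)^[t] (Fin.castLE hnm v) = u).card ≤
          2 * ∑ u ∈ (Finset.univ.filter fun u : Fin m => ∃ᶠ t : ℕ in Filter.atTop,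
            (fun w : Fin m => if o' w = true then σ w else τ w)^[t] (Fin.castLE hnm v) = u),
            ∑ j : Fin m, if x' (Sum.inr (u, j)) = true then 2 ^ (j : ℕ) else 0) ↔
    (∃ σ : Fin n → Fin n, (∀ u, o u = true → x (u, σ u) = true) ∧
      ∀ τ : Fin n → Fin n, (∀ u, o u = false → x (u, τ u) = false) →
        Even ((Finset.univ.filter fun u : Fin n => ∃ᶠ t : ℕ in Filter.atTop,
          (fun w : Fin n => if o w = true then σ w else τ w)^[t] v = u).sup p)) := by
  -- Fin bookkeeping for the embedding `Fin.castLE hnm`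
  have he_lt : ∀ u : Fin n, ((Fin.castLE hnm u : Fin m) : ℕ) < n := fun u => u.2
  have he_mk : ∀ (u' : Fin m) (h : (u' : ℕ) < n), Fin.castLE hnm ⟨u', h⟩ = u' :=
    fun _ _ => Fin.ext rfl
  have he_eta : ∀ (u : Fin n) (h : ((Fin.castLE hnm u : Fin m) : ℕ) < n),
      (⟨((Fin.castLE hnm u : Fin m) : ℕ), h⟩ : Fin n) = u := fun _ _ => Fin.ext rfl
  have he_inj : Function.Injective (Fin.castLE hnm) := Fin.castLE_injective hnm
  have hWlt : ∀ u, W u < 2 ^ m := fun u => by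
    have h := (ptm_weight_bounds hm (hq u)).2
    rw [← hW u] at h
    exact_mod_cast h
  -- the winning condition on the lasso cycle transports along the embedding
  have hgood : ∀ (σ τ : Fin n → Fin n) (σ' τ' : Fin m → Fin m),
      (∀ w, o w = true → σ' (Fin.castLE hnm w) = Fin.castLE hnm (σ w)) →
      (∀ w, o w = false → τ' (Fin.castLE hnm w) = Fin.castLE hnm (τ w)) →
      ((2 ^ m * (Finset.univ.filter fun u : Fin m => ∃ᶠ t : ℕ in Filter.atTop,
            (fun w : Fin m => if o' w = true then σ' w else τ' w)^[t] (Fin.castLE hnm v) = u).card ≤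
          2 * ∑ u ∈ (Finset.univ.filter fun u : Fin m => ∃ᶠ t : ℕ in Filter.atTop,
            (fun w : Fin m => if o' w = true then σ' w else τ' w)^[t] (Fin.castLE hnm v) = u),
            ∑ j : Fin m, if x' (Sum.inr (u, j)) = true then 2 ^ (j : ℕ) else 0) ↔
        Even ((Finset.univ.filter fun u : Fin n => ∃ᶠ t : ℕ in Filter.atTop,
          (fun w : Fin n => if o w = true then σ w else τ w)^[t] v = u).sup p)) := by
    intro σ τ σ' τ' hσ hτ
    have hdyn : ∀ w, (fun w' : Fin m => if o' w' = true then σ' w' else τ' w') (Fin.castLE hnm w) =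
        Fin.castLE hnm ((fun w : Fin n => if o w = true then σ w else τ w) w) := by
      intro w
      simp only [ho'₁]
      cases ho : o w
      · simpa using hτ w ho
      · simpa using hσ w ho
    have hC : (Finset.univ.filter fun u : Fin m => ∃ᶠ t : ℕ in Filter.atTop,
          (fun w : Fin m => if o' w = true then σ' w else τ' w)^[t] (Fin.castLE hnm v) = u) =
        (Finset.univ.filter fun u : Fin n => ∃ᶠ t : ℕ in Filter.atTop,
          (fun w : Fin n => if o w = true then σ w else τ w)^[t] v = u).map ⟨_, he_inj⟩ :=
      ptm_cycle_map (Fin.castLE hnm) he_inj hdyn v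
    rw [hC, Finset.card_map, Finset.sum_map]
    set C := Finset.univ.filter fun u : Fin n => ∃ᶠ t : ℕ in Filter.atTop,
      (fun w : Fin n => if o w = true then σ w else τ w)^[t] v = u with hCdef
    have hCne : C.Nonempty := by
      rw [hCdef]
      exact ptm_cycle_nonempty _ v
    have hWsum : ∀ u : Fin n, (∑ j : Fin m, if x' (Sum.inr (Fin.castLE hnm u, j)) = true
        then 2 ^ (j : ℕ) else 0) = W u := fun u => by
      simp only [hx₄]
      exact ptm_sum_testBit (hWlt u)
    simp only [Function.Embedding.coeFn_mk, hWsum]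
    have hcardN : (C.card : ℤ) ≤ 2 ^ n := by
      have h1 : C.card ≤ n := (Finset.card_le_univ C).trans (by simp)
      have h2 : n < 2 ^ n := Nat.lt_two_pow_self
      exact_mod_cast (h1.trans h2.le)
    rw [← hpq C hCne, ← ptm_sign_iff C hCne q (2 ^ n) hcardN]
    have hcast : (2 ^ m * C.card ≤ 2 * ∑ u ∈ C, W u) ↔
        ((2 : ℤ) ^ m * C.card ≤ 2 * ∑ u ∈ C, (W u : ℤ)) :=
      ⟨fun h => by exact_mod_cast h, fun h => by exact_mod_cast h⟩
    rw [hcast]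
    simp only [hW, Finset.sum_add_distrib, Finset.sum_const, nsmul_eq_mul]
    have h2m : (2 : ℤ) ^ m = 2 * 2 ^ (m - 1) := by
      rw [← pow_succ']
      congr 1
      omega
    rw [h2m]
    set S := ∑ u ∈ C, (-(2 : ℤ) ^ n) ^ q u with hS
    have hring : (2 : ℤ) * ((C.card : ℤ) * 2 ^ (m - 1) + S) =
        2 * 2 ^ (m - 1) * C.card + 2 * S := by ring
    rw [hring, le_add_iff_nonneg_right, mul_nonneg_iff_of_pos_left two_pos]
  constructor
  · rintro ⟨σ', hσ', H'⟩
    -- Even's legal moves from embedded vertices stay embedded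
    have hσ'dn : ∀ u, o u = true → ∃ h : ((σ' (Fin.castLE hnm u) : Fin m) : ℕ) < n,
        x (u, ⟨_, h⟩) = true := by
      intro u hu
      have hl := hσ' (Fin.castLE hnm u) (by rw [ho'₁]; exact hu)
      by_cases h : ((σ' (Fin.castLE hnm u) : Fin m) : ℕ) < n
      · refine ⟨h, ?_⟩
        rw [← hx₁, he_mk]
        exact hl
      · rw [hx₂ u _ h, hu] at hl
        exact absurd hl (by decide)
    refine ⟨fun u => if h : ((σ' (Fin.castLE hnm u) : Fin m) : ℕ) < n then ⟨_, h⟩ else u,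
      fun u hu => ?_, fun τ hτ => ?_⟩
    · obtain ⟨h, hxu⟩ := hσ'dn u hu
      simp only [dif_pos h]
      exact hxu
    · -- extend Odd's `τ` to the big game by the self-loops of the padding
      have key := hgood
        (fun u => if h : ((σ' (Fin.castLE hnm u) : Fin m) : ℕ) < n then ⟨_, h⟩ else u) τ σ'
        (fun u' => if h : (u' : ℕ) < n then Fin.castLE hnm (τ ⟨u', h⟩) else u')
        (fun w hw => by
          obtain ⟨h, -⟩ := hσ'dn w hw
          simp only [dif_pos h, he_mk])
        (fun w _ => by simp only [dif_pos (he_lt w), he_eta])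
      refine key.1 (H' _ fun u' hu' => ?_)
      by_cases h : (u' : ℕ) < n
      · have hu : o ⟨u', h⟩ = false := by rw [← ho'₁, he_mk]; exact hu'
        have hxw := hx₁ ⟨u', h⟩ (τ ⟨u', h⟩)
        rw [he_mk] at hxw
        simp only [dif_pos h]
        rw [hxw]
        exact hτ _ hu
      · rw [ho'₂ u' h] at hu'
        exact absurd hu' (by decide)
  · rintro ⟨σ, hσ, H⟩
    refine ⟨fun u' => if h : (u' : ℕ) < n then Fin.castLE hnm (σ ⟨u', h⟩) else u',
      fun u' hu' => ?_, fun τ' hτ' => ?_⟩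
    · by_cases h : (u' : ℕ) < n
      · have hu : o ⟨u', h⟩ = true := by rw [← ho'₁, he_mk]; exact hu'
        have hxw := hx₁ ⟨u', h⟩ (σ ⟨u', h⟩)
        rw [he_mk] at hxw
        simp only [dif_pos h]
        rw [hxw]
        exact hσ _ hu
      · simp only [dif_neg h]
        rw [hx₃ u' u' h]
        exact decide_eq_true rfl
    · -- Odd's legal moves from embedded vertices stay embedded
      have hτ'dn : ∀ u, o u = false → ∃ h : ((τ' (Fin.castLE hnm u) : Fin m) : ℕ) < n,
          x (u, ⟨_, h⟩) = false := by
        intro u hu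
        have hl := hτ' (Fin.castLE hnm u) (by rw [ho'₁]; exact hu)
        by_cases h : ((τ' (Fin.castLE hnm u) : Fin m) : ℕ) < n
        · refine ⟨h, ?_⟩
          rw [← hx₁, he_mk]
          exact hl
        · rw [hx₂ u _ h, hu] at hl
          exact absurd hl (by decide)
      have key := hgood σ
        (fun u => if h : ((τ' (Fin.castLE hnm u) : Fin m) : ℕ) < n then ⟨_, h⟩ else u)
        (fun u' => if h : (u' : ℕ) < n then Fin.castLE hnm (σ ⟨u', h⟩) else u') τ'
        (fun w _ => by simp only [dif_pos (he_lt w), he_eta])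
        (fun w hw => by
          obtain ⟨h, -⟩ := hτ'dn w hw
          simp only [dif_pos h, he_mk])
      refine key.2 (H _ fun u hu => ?_)
      obtain ⟨h, hxu⟩ := hτ'dn u hu
      simp only [dif_pos h]
      exact hxu

/-- **The gadget, packaged**: for a parity template `(o, p, v)` on `Fin n` and `m` with
`2n² < m` there are a mean-payoff owner map `o'` on `Fin m` and a monotone substitution `ρ`
(every input bit of the mean-payoff game is a constant or an input bit of the parity game) under
which Even wins the threshold mean-payoff game from `Fin.castLE hnm v` iff Even wins the parity
game from `v` — Jurdziński's reduction (1998) as a monotone projection. [folklore] -/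
theorem ptm_gadget {n m : ℕ} (hm : 2 * n ^ 2 < m) (hnm : n ≤ m) (o : Fin n → Bool)
    (p : Fin n → ℕ) (v : Fin n) :
    ∃ (o' : Fin m → Bool) (ρ : (Fin m × Fin m) ⊕ (Fin m × Fin m) → Bool ⊕ (Fin n × Fin n)),
      ∀ x : Fin n × Fin n → Bool,
        ((∃ σ : Fin m → Fin m,
            (∀ u, o' u = true → Sum.elim (fun b => b) x (ρ (Sum.inl (u, σ u))) = true) ∧
            ∀ τ : Fin m → Fin m,
              (∀ u, o' u = false → Sum.elim (fun b => b) x (ρ (Sum.inl (u, τ u))) = false) →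
              2 ^ m * (Finset.univ.filter fun u : Fin m => ∃ᶠ t : ℕ in Filter.atTop,
                  (fun w : Fin m => if o' w = true then σ w else τ w)^[t] (Fin.castLE hnm v) =
                    u).card ≤
                2 * ∑ u ∈ (Finset.univ.filter fun u : Fin m => ∃ᶠ t : ℕ in Filter.atTop,
                  (fun w : Fin m => if o' w = true then σ w else τ w)^[t] (Fin.castLE hnm v) = u),
                  ∑ j : Fin m, if Sum.elim (fun b => b) x (ρ (Sum.inr (u, j))) = true
                    then 2 ^ (j : ℕ) else 0) ↔
          ∃ σ : Fin n → Fin n, (∀ u, o u = true → x (u, σ u) = true) ∧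
            ∀ τ : Fin n → Fin n, (∀ u, o u = false → x (u, τ u) = false) →
              Even ((Finset.univ.filter fun u : Fin n => ∃ᶠ t : ℕ in Filter.atTop,
                (fun w : Fin n => if o w = true then σ w else τ w)^[t] v = u).sup p)) := by
  obtain ⟨q, hq, hqo, hqe⟩ := ptm_compress p
  have hpq : ∀ C : Finset (Fin n), C.Nonempty → (Even (C.sup q) ↔ Even (C.sup p)) :=
    fun C hC => ptm_even_sup_iff hqo hqe C hC
  obtain ⟨W, hWdef⟩ : ∃ W : Fin n → ℕ, W = fun u => (2 ^ (m - 1) + (-(2 : ℤ) ^ n) ^ q u).toNat :=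
    ⟨_, rfl⟩
  have hW : ∀ u, (W u : ℤ) = 2 ^ (m - 1) + (-(2 : ℤ) ^ n) ^ q u := fun u => by
    rw [hWdef]
    exact Int.toNat_of_nonneg (ptm_weight_bounds hm (hq u)).1
  obtain ⟨o', ho'⟩ : ∃ o' : Fin m → Bool,
      o' = fun u' : Fin m => if h : (u' : ℕ) < n then o ⟨u', h⟩ else true :=
    ⟨_, rfl⟩
  obtain ⟨ρ, hρ⟩ : ∃ ρ : (Fin m × Fin m) ⊕ (Fin m × Fin m) → Bool ⊕ (Fin n × Fin n), ρ =
      Sum.elim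
        (fun uw => if hu : (uw.1 : ℕ) < n then
          (if hw : (uw.2 : ℕ) < n then Sum.inr (⟨uw.1, hu⟩, ⟨uw.2, hw⟩)
            else Sum.inl (!o ⟨uw.1, hu⟩))
          else Sum.inl (decide (uw.2 = uw.1)))
        (fun uj => Sum.inl (if hu : (uj.1 : ℕ) < n then (W ⟨uj.1, hu⟩).testBit uj.2 else false)) :=
    ⟨_, rfl⟩
  refine ⟨o', ρ, fun x => ?_⟩
  have he_lt : ∀ u : Fin n, ((Fin.castLE hnm u : Fin m) : ℕ) < n := fun u => u.2
  exact ptm_reduction hm hnm o p q hq hpq v o'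
    (fun u => by simp only [ho', dif_pos (he_lt u)]; rfl)
    (fun u' h => by simp only [ho', dif_neg h]) W hW x (fun k => Sum.elim (fun b => b) x (ρ k))
    (fun u w => by
      simp only [hρ, Sum.elim_inl, Sum.elim_inr, dif_pos (he_lt u), dif_pos (he_lt w)]; rfl)
    (fun u w' hw => by simp only [hρ, Sum.elim_inl, dif_pos (he_lt u), dif_neg hw]; rfl)
    (fun u' w' hu => by simp only [hρ, Sum.elim_inl, dif_neg hu])
    (fun u j => by simp only [hρ, Sum.elim_inl, Sum.elim_inr, dif_pos (he_lt u)]; rfl)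

/-! ## §2 The glue -/

/-- **Glue S4 of route PneNP/PositionalGames** (item stmt-PneNP-1301): superpolynomial monotone
lower bounds for parity games transfer to threshold mean-payoff games with `n`-bit weights,
`ParityMonotoneSuperpoly → MpgMonotoneSuperpoly`. Given `k`, take parity hardness at exponent
`2k+1` from `N₀` on; for `m ≥ 2N²+1` (`N = max N₀ (8^k+1)`) let `n` be the largest number with
`2n² < m` (so `n ≥ N` and `m ≤ 2(n+1)² ≤ 8n²`); a parity template on `Fin n` of monotone complexity
`> n^{2k+1} > m^k` is a monotone projection of the Jurdziński mean-payoff template on `Fin m`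
(`ptm_gadget`), whose monotone complexity is therefore at least as large (`ptm_transfer_step`:
constant elimination `substElim_wire`, and the mean-payoff function is monotone and non-constant,
hence has a `{∧₂, ∨₂}`-circuit). -/
theorem parityToMpg_proof : Summit.PneNP.PneNP.Theses.PositionalGames.ParityToMpg := by
  unfold Summit.PneNP.PneNP.Theses.PositionalGames.ParityToMpg
    Summit.PneNP.PneNP.Theses.PositionalGames.ParityMonotoneSuperpoly
    Summit.PneNP.PneNP.Theses.PositionalGames.MpgMonotoneSuperpoly
  intro hPar k
  obtain ⟨N₀, hN₀⟩ := Filter.eventually_atTop.1 (hPar (2 * k + 1))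
  refine Filter.eventually_atTop.2 ⟨2 * (max N₀ (8 ^ k + 1)) ^ 2 + 1, fun m hm => ?_⟩
  set N := max N₀ (8 ^ k + 1) with hNdef
  have hN8 : 8 ^ k + 1 ≤ N := le_max_right _ _
  have hN0 : N₀ ≤ N := le_max_left _ _
  have hPN : 2 * N ^ 2 < m := hm
  have hNm : N ≤ m := by
    have := Nat.le_self_pow two_ne_zero N
    omega
  -- `n` := the largest number with `2 n² < m`
  obtain ⟨n, hPn, hNn, hmn⟩ : ∃ n, 2 * n ^ 2 < m ∧ N ≤ n ∧ m ≤ 2 * (n + 1) ^ 2 := by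
    refine ⟨Nat.findGreatest (fun n => 2 * n ^ 2 < m) m,
      Nat.findGreatest_spec (P := fun n => 2 * n ^ 2 < m) hNm hPN,
      Nat.le_findGreatest (P := fun n => 2 * n ^ 2 < m) hNm hPN, ?_⟩
    have hle : Nat.findGreatest (fun n => 2 * n ^ 2 < m) m ≤ m := Nat.findGreatest_le m
    have hsp : 2 * (Nat.findGreatest (fun n => 2 * n ^ 2 < m) m) ^ 2 < m :=
      Nat.findGreatest_spec (P := fun n => 2 * n ^ 2 < m) hNm hPN
    have hlt : Nat.findGreatest (fun n => 2 * n ^ 2 < m) m < m := by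
      rcases hle.lt_or_eq with h | h
      · exact h
      · exfalso
        rw [h] at hsp
        nlinarith
    exact not_lt.1 (Nat.findGreatest_is_greatest (P := fun n => 2 * n ^ 2 < m)
      (Nat.lt_succ_self _) hlt)
  have h8pos : 1 ≤ 8 ^ k := Nat.one_le_pow _ _ (by norm_num)
  have hn1 : 1 ≤ n := by omega
  have h8 : 8 ^ k < n := by omega
  have hmk : m ^ k < n ^ (2 * k + 1) := by
    have hm8 : m ≤ 8 * n ^ 2 := by nlinarith
    calc m ^ k ≤ (8 * n ^ 2) ^ k := Nat.pow_le_pow_left hm8 k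
      _ = 8 ^ k * n ^ (2 * k) := by rw [mul_pow, ← pow_mul]
      _ < n * n ^ (2 * k) := mul_lt_mul_of_pos_right h8 (pow_pos (by omega) _)
      _ = n ^ (2 * k + 1) := (pow_succ' n (2 * k)).symm
  -- a hard parity template on `n` vertices, projected into a mean-payoff template on `m`
  obtain ⟨o, p, v, hlt⟩ := hN₀ n (hN0.trans hNn)
  have hnm : n ≤ m := by
    have := Nat.le_self_pow two_ne_zero n
    omega
  obtain ⟨o', ρ, hρ⟩ := ptm_gadget hPn hnm o p v
  refine ⟨o', Fin.castLE hnm v, lt_of_lt_of_le (hmk.trans hlt)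
    (ptm_transfer_step ρ (fun x => ?_) ?_ ((Nat.zero_le _).trans_lt hlt))⟩
  · dsimp only
    exact decide_eq_decide.mpr (hρ x)
  · refine ptm_monotone_decide fun x y hxy hx => ?_
    exact ptm_mpg_mono o' _ hxy hx

end Summit.PneNP.PneNP.Theorems
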